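/-
Copyright (c) 2026 the pub-hodgecm-mathlib formalisation cell (harness21).  Prover seat hodgecm-mathlib-K2E4-p23 (g3), Track B ∕ K2-LIT, h413 =
`stmt-HodgeConjecture-24833`, ENGINE E1, 5Res campaign «ENDGAME BY FAMILIES», RUNG 1, deal (273)(iii) plan (P2): the SELF-DUAL per-block package of the RUNG-1 socket
(★ p861000∕★ p861518 §2) at the maximal level — FILE B, the family half (rank one at `K_max`, the block identification, the non-vanishing letter `hMne` from the M1 functional
equation, and the all-of-`L²` model intertwining `U R(η) = (diag ŝ(c) ⊕ M_{ŝ(½+i·)}) U` with the Weyl symmetry `hsymm` DISCHARGED).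
-/
import Summits.HodgeConjecture.HodgeConjecture.Theorems.K2E1ResidualBlockPackageOffDualM1CMTwo              -- ★ p861419 (K2E4-p14): OD FILE 1c ⇒ FILE 1b (`mem_bricks_of_ae_eq`) ⇒ FILE 1a (`exists_offDual_hecke_on_fix`, bricks∕`P_1` algebra) ⇒ FILE 0
import Summits.HodgeConjecture.HodgeConjecture.Theorems.K2E1ChiSectionPlancherelSelfDualM1CMTwoSqrt           -- ★ p861360 (K2E1-p14): the letter-free rank-one SD isometry with residue coordinate (+ ★ M1 package, ★ FE p860766)
import Summits.HodgeConjecture.HodgeConjecture.Theorems.K2E1ChiSectionHeckeIntertwiningSelfDualCMTwo          -- ★ (K2E1-p11): `hU_selfDual_cm_two`, `memLp_top_axis`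
import Summits.HodgeConjecture.HodgeConjecture.Theorems.K2E1SelfDualModelHeckeIntertwiningGlobal              -- ★ p861303 (K2E1-p11): `hU_selfDual_global`
import Summits.HodgeConjecture.HodgeConjecture.Theorems.K2E1ChiSymbolWeylSymmetrySelfDualCMTwo                -- ★ (K2E2-p12): `chi_symbol_symm_of_selfDual_cm_two` (mod `hMne`)
import Summits.HodgeConjecture.HodgeConjecture.Theorems.K2E1ChiSymbolWeylSymmetryM1CMTwo                      -- ★ (K2E1-p16): `symbol_axis_symm`
import Summits.HodgeConjecture.HodgeConjecture.Theorems.K2E1ChiScatteringFunctionalEquationM1CMTwo            -- ★ p860766 (K2E1-p14 lineage): `chi_scattering_fe_m1_cm_two`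
import Literature.NumberTheory.Automorphic.UnitaryGroupIwasawaAdelic                                         -- ★ `exists_mem_borelAdelic_mul_mem_standardMaximalCompactGL_cm`
import HarnessLib

/-!
# K2·E1 — `K2E1ResidualBlockPackageSelfDualFamilyCMTwo`: THE SELF-DUAL FAMILY AT THE MAXIMAL LEVEL, ITS BLOCK AND ITS MODEL INTERTWINING (FILE B of the SD block package, RUNG 1)

Track B ∕ K2-LIT, crux h413 = `stmt-HodgeConjecture-24833`, route of record `HCCMUnconditional`; cell `hodgecm-mathlib`, squad K2, ENGINE E1.  Prover seat `hodgecm-mathlib-K2E4-p23` (g3);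
deal (273)(iii) plan (P2) of K2E1-plan (g7) (HANDOFF g2 → g3).  THEOREMS ONLY (no `def`, no `instance`, no notation, no named-fact hypothesis, no `sorry`); lane
`--supports stmt-HodgeConjecture-24833 --as helper` (count-neutral).  CLOSES NO SOCKET.  Frame: `G = U(J₂) = quasiSplit L⁺ L c 2`, `K = K_∞·GL₂(𝒪̂_L) = comap adelicVal K_GL` (M1).

THE MATHEMATICS ([MoeglinWaldspurger1995, II.2.4, IV.1.10, IV.3.12, VI.2]; [ReedSimonI1980, Thm. I.7, II.3]; [Langlands1976, §7]).  The RUNG-1 socket (★ p861518 §2) binds, per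
SELF-DUAL block `χ` (`χʷ = χ`, unitary, trivial on `ℝ_{>0}`, `V(χ, K, 1) ∋ φ ≠ 0` with `φ ∘ ι_∞ = φ(1)` — the M1 datum), the data `(gen, A, Ω, m, E, V, hV, Jb, h, hhl, hhr, s, hs, hU, hline)`.
This file supplies the FAMILY half (the mirror of K2E4-p14's OD FILE 1b ★ p861374 for the self-dual model `(⊕_{c∈S} W) ⊕₂ L²((0,∞); W)` of ★ p861360):
(§1) RANK ONE AT `K_max`: `V(χ, K, 1) = ℂ·φ` (adelic Iwasawa `G = B·K`, ★ `exists_mem_borelAdelic_mul_mem_standardMaximalCompactGL_cm`), whence the C7″ block of `χ` (closed span of the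
C⁰-bricks `[θ_{f,φ'}]`, `φ' ∈ V(χ, K, 1)` continuous) IS the closed span of the `C²_c`-profile family `x_f = [θ_{f,φ}]` (★ p860789: C⁰- and C^∞-profile bricks have the same closed span);
(§2) THE NON-VANISHING LETTER `hMne` of ★ `chi_symbol_symm_of_selfDual_cm_two` DISCHARGED at M1: the M1 scattering scalar satisfies `c(z)c(1−z) = 1` off its closed codiscrete pole set
`P ⊆ {Re ≤ 1}` (★ p860766), so `c(z₀) ≠ 0` at some Godement point `Re z₀ > 1`, and by the tube formula (★ M1 package) the intertwining integral of `φ` at `z₀` is non-zero;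
(§3) THE ALL-OF-`L²` INTERTWINING: for ANY real symmetric `η ∈ C_c(G(𝔸))` acting on `V(χ, K, 1)`'s flat sections by an entire symbol `ŝ` (e.g. ★ FILE 1a's gauge self-convolution), the family is
closed under the smoothing profile of `η` (★ smoothing-profile lemmas), `ŝ(z) = ŝ(1 − z)` (★ K2E2-p12 with §2's `hMne`; axis form ★ `symbol_axis_symm`), so ★ `hU_selfDual_cm_two` gives
`U_iso(R(η)v) = ((ŝ(c)•(U_iso v)_c)_c, ŝ(½+i·)•(U_iso v)_cont)` on the closed span `Θ` and `R(η)Θ ⊆ Θ`; `R(η)† = R(η)` (★ `adjoint_integratedOperator`) so `hadjΘ` holds and ★ `hU_selfDual_global`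
extends the intertwining to ALL `v ∈ L²` for `U = U_iso ∘ P_Θ`.
* §0 `snd_modelMap_comp_eq_smul` (three lines of linear algebra on `WithLp 2 (A × M)`).  * §1 `eq_smul_of_mem_chiSectionSpace_maximalLevel`, `toLp_brick_smul_section`,
  **`topologicalClosure_span_bricks_eq_selfDual`**.  * §2 **`hMne_maximalLevel_cm_two`**.  * §3 `integratedOperator_mem_closure_span_selfDual`, **`exists_selfDual_modelMap_intertwining`**.
BINDERS LEFT VISIBLE (structural, ★-inhabited: the M1 package's measures∕domains `νG μKU νI 𝓕I ν 𝓕 β μZ` exactly as ★ p861360 §3; `χ` unitary, ray-trivial, self-dual; ONE section `φ ∈ V(χ, K, 1)`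
continuous, bounded, `φ ∘ ι_∞ = φ(1)` (the M1 datum letter `hφinf`), `φ(1) ≠ 0` real).
HONEST LABEL: HC_CM is proved only modulo the 7 printed citations (2 remaining named inputs: hLiu418 = `stmt-HodgeConjecture-24832`, h413 = `stmt-HodgeConjecture-24833`) until rung 0
closes; this file asserts no named fact and closes no socket; count-neutral; RUNG 1 (mod the SD head + FINAL) ≠ 5Res.

## References
* [MoeglinWaldspurger1995] C. Mœglin, J.-L. Waldspurger, *Spectral decomposition and Eisenstein series* (1995), II.1.2, II.2.4, IV.1.10, IV.3.12, VI.2.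
* [ReedSimonI1980] M. Reed, B. Simon, *Methods of Modern Mathematical Physics I* (1980), Thm. I.7, Thm. II.3.
* [Langlands1976] R. P. Langlands, *On the Functional Equations Satisfied by Eisenstein Series*, LNM 544 (1976), §7.
* [BorelJacquet1979] A. Borel, H. Jacquet, PSPM 33.1 (1979), §4.1.
* [Garrett2018] P. Garrett, *Modern Analysis of Automorphic Forms by Example* (2018), §2.8.
-/

set_option autoImplicit false
-- the mandated namespace repeats the single-problem summit's segment (`HodgeConjecture.HodgeConjecture`)
set_option linter.dupNamespace false

noncomputable section

open MeasureTheory MeasureTheory.Measure Filter Topology CompactlySupported NumberField NumberField.mixedEmbedding NumberField.InfinitePlace IsDedekindDomain Set Complex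
open scoped ENNReal NNReal ComplexConjugate InnerProductSpace Real
open Literature.NumberTheory Literature.NumberTheory.Automorphic Literature.NumberTheory.Automorphic.UnitaryGroup AdelicGroupData ContRepresentation
open Literature.NumberTheory.GaloisRepresentations (HeckeCharacter)
open Literature.MeasureTheory.Group
open Summit.HodgeConjecture.HodgeConjecture.Cruxes.H413.K2E1BorelEisensteinU
open Summit.HodgeConjecture.HodgeConjecture.Cruxes.H413.K2E1BLBorelSpacesU2Defs
open Summit.HodgeConjecture.HodgeConjecture.Cruxes.H413.K2E1BLBorelOperatorsU2Defs
open Summit.HodgeConjecture.HodgeConjecture.Cruxes.H413.K2E1CharacterEisensteinU2Defs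
open Summit.HodgeConjecture.HodgeConjecture.Cruxes.H413.K2E1ChiSectionSpaceU2Defs
open Summit.HodgeConjecture.HodgeConjecture.Cruxes.H413.K2E1PlancherelIsometryOfForm (mem_topologicalClosure_span)
open Summit.HodgeConjecture.HodgeConjecture.Cruxes.H413.K2E1PlancherelModelMapOfIsometry (completeSpace_topologicalClosure_span modelMap_apply_of_mem modelMap_apply_eq_modelMap_proj)
open Summit.HodgeConjecture.HodgeConjecture.Cruxes.H413.K2E1ChiSectionHeckeIntertwiningSelfDualCMTwo (hU_selfDual_cm_two memLp_top_axis)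
open Summit.HodgeConjecture.HodgeConjecture.Cruxes.H413.K2E1SelfDualModelHeckeIntertwiningGlobal (hU_selfDual_global)
open Summit.HodgeConjecture.HodgeConjecture.Cruxes.H413.K2E1ChiSymbolWeylSymmetrySelfDualCMTwo (chi_symbol_symm_of_selfDual_cm_two)
open Summit.HodgeConjecture.HodgeConjecture.Cruxes.H413.K2E1ChiSymbolWeylSymmetryM1CMTwo (symbol_axis_symm)
open Summit.HodgeConjecture.HodgeConjecture.Cruxes.H413.K2E1ChiScatteringRealPolesM1CMTwoComplete (chi_scattering_real_poles_m1_complete_cm_two)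
open Summit.HodgeConjecture.HodgeConjecture.Cruxes.H413.K2E1ChiScatteringFunctionalEquationM1CMTwo (chi_scattering_fe_m1_cm_two)
open Summit.HodgeConjecture.HodgeConjecture.Cruxes.H413.K2E1PseudoEisensteinSmoothBricksDenseU2 (topologicalClosure_span_continuous_eq_smooth)
open Summit.HodgeConjecture.HodgeConjecture.Cruxes.H413.K2E1ChiSectionBoundedOfUnitaryU2 (exists_bound_of_isChiSection_of_isUnitary hχb_of_isUnitary)
open Summit.HodgeConjecture.HodgeConjecture.Cruxes.H413.K2E1ChiSectionSmoothingProfileU2 (contDiff_smoothingProfile hasCompactSupport_smoothingProfile tsupport_smoothingProfile_subset_Ioi)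
open Summit.HodgeConjecture.HodgeConjecture.Cruxes.H413.K2E1ResidualBlockPackageOffDualFamilyCMTwo (mem_bricks_of_ae_eq)

namespace Summit.HodgeConjecture.HodgeConjecture.Cruxes.H413.K2E1ResidualBlockPackageSelfDualFamilyCMTwo

/-! ## §0 Linear algebra: the second model coordinate through `P_G`, `P_1` and the model map -/

section Abstract

variable {H A M S : Type*} [AddCommGroup H] [Module ℂ H] [NormedAddCommGroup A] [InnerProductSpace ℂ A] [NormedAddCommGroup M] [InnerProductSpace ℂ M] [HSMul S M M]

/-- `(ofLp ((U ∘ P_G)(T v))).2 = c • (ofLp ((U ∘ P_G) v)).2` from `T v = P_1 w`, `P_G P_1 = P_G`, `U P_G = U`, `(ofLp (U w)).2 = c • (ofLp (U v)).2` — the `WithLp 2 (A × M)` twin of ★ FILE 1b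
`snd_prod_comp_eq_smul`, in ★ p860973 `blockPackage_hU`'s plain-product currency `V := WithLp.linearEquiv ∘ₗ U`. [folklore] -/
theorem snd_modelMap_comp_eq_smul (U : H →ₗ[ℂ] WithLp 2 (A × M)) (PG : H →ₗ[ℂ] H) {P₁ : H → H} {w₁ w₂ v : H} (c : S)
    (hT : w₁ = P₁ w₂) (hPG : ∀ w, PG (P₁ w) = PG w) (hUG : ∀ w, U (PG w) = U w) (hU : (WithLp.ofLp (U w₂)).2 = c • (WithLp.ofLp (U v)).2) :
    ((((WithLp.linearEquiv 2 ℂ (A × M)).toLinearMap ∘ₗ U) ∘ₗ PG) w₁).2 = c • ((((WithLp.linearEquiv 2 ℂ (A × M)).toLinearMap ∘ₗ U) ∘ₗ PG) v).2 := by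
  change (WithLp.ofLp (U (PG w₁))).2 = c • (WithLp.ofLp (U (PG v))).2
  rw [hT, hPG, hUG, hUG, hU]

end Abstract

variable (L : Type) [Field L] [NumberField L] [IsCMField L]
  (μ : Measure (quasiSplit (↥(maximalRealSubfield L)) L (IsCMField.complexConj L) 2).automorphicQuotient)
  [MeasurableSpace (quasiSplit (↥(maximalRealSubfield L)) L (IsCMField.complexConj L) 2).Adelic] [BorelSpace (quasiSplit (↥(maximalRealSubfield L)) L (IsCMField.complexConj L) 2).Adelic]

/-! ## §1 Rank one at `K_max` and the identification of the C7″ block with the closed span of the self-dual family -/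

section RankOne

omit [MeasurableSpace (quasiSplit (↥(maximalRealSubfield L)) L (IsCMField.complexConj L) 2).Adelic] [BorelSpace (quasiSplit (↥(maximalRealSubfield L)) L (IsCMField.complexConj L) 2).Adelic] in
/-- **RANK ONE AT THE MAXIMAL LEVEL**: two sections `φ, φ' ∈ V(χ, K, 1)` with `φ(1) ≠ 0` are proportional, `φ' = (φ'(1)·φ(1)⁻¹)•φ` — adelic Iwasawa `g = b·k` (★
`exists_mem_borelAdelic_mul_mem_standardMaximalCompactGL_cm`) and the two-sided rule `φ(b·s·k) = χ(b₀₀)·φ(s)` (★ `apply_borel_mul_mul_of_mem`) at `s = 1`. [cite: BorelJacquet1979, §4.1]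
[cite: MoeglinWaldspurger1995, I.2.17] -/
theorem eq_smul_of_mem_chiSectionSpace_maximalLevel {χ : HeckeCharacter L} {φ φ' : (quasiSplit (↥(maximalRealSubfield L)) L (IsCMField.complexConj L) 2).Adelic → ℂ}
    (hφ : φ ∈ chiSectionSpace χ ((standardMaximalCompactGL 2 L).comap (adelicVal (↥(maximalRealSubfield L)) L (IsCMField.complexConj L) 2 ((StdForm.antidiagonal 2).over L)) : Subgroup (quasiSplit (↥(maximalRealSubfield L)) L (IsCMField.complexConj L) 2).Adelic) 1) (hφ' : φ' ∈ chiSectionSpace χ ((standardMaximalCompactGL 2 L).comap (adelicVal (↥(maximalRealSubfield L)) L (IsCMField.complexConj L) 2 ((StdForm.antidiagonal 2).over L)) : Subgroup (quasiSplit (↥(maximalRealSubfield L)) L (IsCMField.complexConj L) 2).Adelic) 1) (hφ1 : φ 1 ≠ 0) :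
    φ' = (φ' 1 * (φ 1)⁻¹) • φ := by
  funext g
  obtain ⟨b, hb, k, hk, rfl⟩ := exists_mem_borelAdelic_mul_mem_standardMaximalCompactGL_cm L (N := 2) g
  have hk' : k ∈ ((standardMaximalCompactGL 2 L).comap (adelicVal (↥(maximalRealSubfield L)) L (IsCMField.complexConj L) 2 ((StdForm.antidiagonal 2).over L)) : Subgroup (quasiSplit (↥(maximalRealSubfield L)) L (IsCMField.complexConj L) 2).Adelic) := Subgroup.mem_comap.2 hk
  have h1 := apply_borel_mul_mul_of_mem hφ hb 1 ⟨k, hk'⟩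
  have h2 := apply_borel_mul_mul_of_mem hφ' hb 1 ⟨k, hk'⟩
  rw [mul_one] at h1 h2
  rw [Pi.smul_apply, smul_eq_mul, h2, h1]
  simp only [Pi.one_apply, mul_one]
  field_simp

omit [MeasurableSpace (quasiSplit (↥(maximalRealSubfield L)) L (IsCMField.complexConj L) 2).Adelic] [BorelSpace (quasiSplit (↥(maximalRealSubfield L)) L (IsCMField.complexConj L) 2).Adelic] in
/-- The brick of a rescaled section is the rescaled brick: `[θ_{f, a•φ}] = a • [θ_{f,φ}]` (★ `eisensteinSeriesU_smul`, `quotFun_smul`). [folklore] [cite: MoeglinWaldspurger1995, II.1.5] -/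
theorem toLp_brick_smul_section {f : ℝ → ℂ} {φ : (quasiSplit (↥(maximalRealSubfield L)) L (IsCMField.complexConj L) 2).Adelic → ℂ} (a : ℂ)
    (hv : MemLp ((quasiSplit (↥(maximalRealSubfield L)) L (IsCMField.complexConj L) 2).quotFun (eisensteinSeriesU (fun g : (quasiSplit (↥(maximalRealSubfield L)) L (IsCMField.complexConj L) 2).Adelic => f (borelHeight g : ℝ) * φ g))) 2 μ)
    (hva : MemLp ((quasiSplit (↥(maximalRealSubfield L)) L (IsCMField.complexConj L) 2).quotFun (eisensteinSeriesU (fun g : (quasiSplit (↥(maximalRealSubfield L)) L (IsCMField.complexConj L) 2).Adelic => f (borelHeight g : ℝ) * (a • φ) g))) 2 μ) :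
    hva.toLp _ = a • hv.toLp _ := by
  have hfun : (fun g : (quasiSplit (↥(maximalRealSubfield L)) L (IsCMField.complexConj L) 2).Adelic => f (borelHeight g : ℝ) * (a • φ) g) = a • (fun g : (quasiSplit (↥(maximalRealSubfield L)) L (IsCMField.complexConj L) 2).Adelic => f (borelHeight g : ℝ) * φ g) := by
    funext g; simp only [Pi.smul_apply, smul_eq_mul]; ring
  have hE : eisensteinSeriesU (fun g : (quasiSplit (↥(maximalRealSubfield L)) L (IsCMField.complexConj L) 2).Adelic => f (borelHeight g : ℝ) * (a • φ) g) = a • eisensteinSeriesU (fun g : (quasiSplit (↥(maximalRealSubfield L)) L (IsCMField.complexConj L) 2).Adelic => f (borelHeight g : ℝ) * φ g) := by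
    funext g; rw [hfun, eisensteinSeriesU_smul, Pi.smul_apply, smul_eq_mul]
  refine Lp.ext (hva.coeFn_toLp.trans ?_)
  rw [hE, AdelicGroupData.quotFun_smul]
  exact ((Lp.coeFn_smul a (hv.toLp _)).trans (hv.coeFn_toLp.mono fun x hx => by rw [Pi.smul_apply, Pi.smul_apply, hx])).symm

variable [(quasiSplit (↥(maximalRealSubfield L)) L (IsCMField.complexConj L) 2).IsAutomorphicMeasure μ] in
/-- **THE C7″ BLOCK OF A SELF-DUAL `χ` AT `K_max` IS THE CLOSED SPAN OF THE RANK-ONE FAMILY**: for unitary `χ` and ONE continuous `φ ∈ V(χ, K, 1)` with `φ(1) ≠ 0`, the closed span of the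
C⁰-profile bricks `[θ_{f,φ'}]` (`φ' ∈ V(χ, K, 1)` continuous) EQUALS the closed span of any family of `L²`-representatives `x_f =ᵐ quotFun θ_{f, 1•φ}` indexed by ALL `C²_c((0,∞))`-profiles
(`x_f = Σ_{a : Unit} y_{f,a}` in ★ p861360's shape) — `⊇`: each `x_f` is a C⁰-brick; `⊆`: ★ `topologicalClosure_span_continuous_eq_smooth` and §1 rank one (`φ' = λ•φ`, `[θ_{f,φ'}] = λ•x_f`).
[cite: MoeglinWaldspurger1995, II.1.2, II.2.4] -/
theorem topologicalClosure_span_bricks_eq_selfDual {χ : HeckeCharacter L} (hχu : χ.IsUnitary)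
    {φ : (quasiSplit (↥(maximalRealSubfield L)) L (IsCMField.complexConj L) 2).Adelic → ℂ} (hφV : φ ∈ chiSectionSpace χ ((standardMaximalCompactGL 2 L).comap (adelicVal (↥(maximalRealSubfield L)) L (IsCMField.complexConj L) 2 ((StdForm.antidiagonal 2).over L)) : Subgroup (quasiSplit (↥(maximalRealSubfield L)) L (IsCMField.complexConj L) 2).Adelic) 1) (hφc : Continuous φ) (hφ1 : φ 1 ≠ 0)
    {Idx : Set (ℝ → ℂ)} (hI : Idx = {f : ℝ → ℂ | ContDiff ℝ 2 f ∧ HasCompactSupport f ∧ tsupport f ⊆ Ioi 0})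
    (y : ↥Idx → Unit → (quasiSplit (↥(maximalRealSubfield L)) L (IsCMField.complexConj L) 2).L2 μ)
    (hy : ∀ (i : ↥Idx) (a : Unit), (y i a : (quasiSplit (↥(maximalRealSubfield L)) L (IsCMField.complexConj L) 2).automorphicQuotient → ℂ) =ᵐ[μ] (quasiSplit (↥(maximalRealSubfield L)) L (IsCMField.complexConj L) 2).quotFun (eisensteinSeriesU (fun g : (quasiSplit (↥(maximalRealSubfield L)) L (IsCMField.complexConj L) 2).Adelic => (i : ℝ → ℂ) (borelHeight g : ℝ) * ((fun _ : Unit => (1 : ℂ) • φ) a) g))) :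
    (Submodule.span ℂ {v : (quasiSplit (↥(maximalRealSubfield L)) L (IsCMField.complexConj L) 2).L2 μ |
        ∃ (f : ℝ → ℂ) (_ : Continuous f) (_ : HasCompactSupport f) (_ : tsupport f ⊆ Ioi 0)
          (φ' : (quasiSplit (↥(maximalRealSubfield L)) L (IsCMField.complexConj L) 2).Adelic → ℂ) (_ : φ' ∈ chiSectionSpace χ ((standardMaximalCompactGL 2 L).comap (adelicVal (↥(maximalRealSubfield L)) L (IsCMField.complexConj L) 2 ((StdForm.antidiagonal 2).over L)) : Subgroup (quasiSplit (↥(maximalRealSubfield L)) L (IsCMField.complexConj L) 2).Adelic) 1) (_ : Continuous φ')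
          (hv : MemLp ((quasiSplit (↥(maximalRealSubfield L)) L (IsCMField.complexConj L) 2).quotFun (eisensteinSeriesU (fun g => f (borelHeight g) * φ' g))) 2 μ), v = hv.toLp _}).topologicalClosure = (Submodule.span ℂ (Set.range fun i : ↥Idx => ∑ a, y i a)).topologicalClosure := by
  subst hI
  have hφ1V : ((1 : ℂ) • φ) ∈ chiSectionSpace χ ((standardMaximalCompactGL 2 L).comap (adelicVal (↥(maximalRealSubfield L)) L (IsCMField.complexConj L) 2 ((StdForm.antidiagonal 2).over L)) : Subgroup (quasiSplit (↥(maximalRealSubfield L)) L (IsCMField.complexConj L) 2).Adelic) 1 := Submodule.smul_mem _ _ hφV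
  have hφ1c : Continuous ((1 : ℂ) • φ) := hφc.const_smul _
  have hsum : ∀ i : ↥{f : ℝ → ℂ | ContDiff ℝ 2 f ∧ HasCompactSupport f ∧ tsupport f ⊆ Ioi 0}, ∑ a, y i a = y i () := fun i => Fintype.sum_unique _
  apply le_antisymm
  · -- `⊆`: through the smooth bricks and rank one
    rw [topologicalClosure_span_continuous_eq_smooth L μ χ _ (hχb_of_isUnitary L hχu _)]
    refine Submodule.topologicalClosure_minimal _ (Submodule.span_le.2 ?_) (Submodule.isClosed_topologicalClosure _)
    rintro v ⟨f, hf, -, hfs, hf0, φ', hφ', -, hv, rfl⟩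
    have hi : f ∈ {f : ℝ → ℂ | ContDiff ℝ 2 f ∧ HasCompactSupport f ∧ tsupport f ⊆ Ioi 0} := ⟨hf.of_le (WithTop.coe_le_coe.2 le_top), hfs, hf0⟩
    have hrk : φ' = (φ' 1 * (((1 : ℂ) • φ) 1)⁻¹) • ((1 : ℂ) • φ) :=
      eq_smul_of_mem_chiSectionSpace_maximalLevel L hφ1V hφ' (by rw [Pi.smul_apply, one_smul]; exact hφ1)
    have hv1 : MemLp ((quasiSplit (↥(maximalRealSubfield L)) L (IsCMField.complexConj L) 2).quotFun (eisensteinSeriesU (fun g : (quasiSplit (↥(maximalRealSubfield L)) L (IsCMField.complexConj L) 2).Adelic => f (borelHeight g : ℝ) * ((1 : ℂ) • φ) g))) 2 μ := (Lp.memLp (y ⟨f, hi⟩ ())).ae_eq (hy ⟨f, hi⟩ ())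
    have hy1 : y ⟨f, hi⟩ () = hv1.toLp _ := Lp.ext ((hy ⟨f, hi⟩ ()).trans hv1.coeFn_toLp.symm)
    have hva : MemLp ((quasiSplit (↥(maximalRealSubfield L)) L (IsCMField.complexConj L) 2).quotFun (eisensteinSeriesU (fun g : (quasiSplit (↥(maximalRealSubfield L)) L (IsCMField.complexConj L) 2).Adelic => f (borelHeight g : ℝ) * ((φ' 1 * (((1 : ℂ) • φ) 1)⁻¹) • ((1 : ℂ) • φ)) g))) 2 μ := by rw [← hrk]; exact hv
    have heq : hv.toLp _ = (φ' 1 * (((1 : ℂ) • φ) 1)⁻¹) • ∑ a, y ⟨f, hi⟩ a := by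
      rw [hsum, hy1, ← toLp_brick_smul_section L μ (φ' 1 * (((1 : ℂ) • φ) 1)⁻¹) hv1 hva]
      congr 1
      · simp only [hrk.symm]
    rw [SetLike.mem_coe, heq]
    exact Submodule.smul_mem _ _ (Submodule.le_topologicalClosure _ (Submodule.subset_span (Set.mem_range_self _)))
  · -- `⊇`: each representative is a C⁰-brick
    refine Submodule.topologicalClosure_mono (Submodule.span_mono ?_)
    rintro _ ⟨i, rfl⟩
    obtain ⟨hf, hfs, hf0⟩ := i.2
    show ∑ a, y i a ∈ _
    rw [hsum]
    exact mem_bricks_of_ae_eq L μ hf.continuous hfs hf0 hφ1V hφ1c (hy i ())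

end RankOne

/-! ## §2 The non-vanishing letter `hMne` at M1 from the functional equation of the scattering scalar -/

section Mne

variable [MeasurableSpace (AdeleRing (𝓞 L) L)ˣ] [BorelSpace (AdeleRing (𝓞 L) L)ˣ]
  [(quasiSplit (↥(maximalRealSubfield L)) L (IsCMField.complexConj L) 2).IsAutomorphicMeasure μ]

include μ in
/-- **`hMne` AT M1** (the one letter of ★ `chi_symbol_symm_of_selfDual_cm_two`, DISCHARGED): for the M1 datum `(χ, φ)` the intertwining integral `∫_N f_{z₀}^φ(w₀ v) dν` is non-zero at some
Godement point `Re z₀ > 1` — the M1 scattering scalar `c = qc` satisfies `c(z)c(1−z) = 1` off its closed, codiscrete pole set `P ⊆ {Re ≤ 1}` (★ package ∘ ★ `chi_scattering_fe_m1_cm_two`), so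
`c(z₀) ≠ 0` for `z₀ = 1 − s₁` with `s₁ ∉ P`, `Re s₁ < 0`; and `c(z₀) = (ν𝓕)⁻¹·φ(1)⁻¹·∫_N f_{z₀}^φ(w₀(v·1)) dν` (tube formula). [cite: MoeglinWaldspurger1995, IV.1.10, II.1.7] [cite: Langlands1976, §7] -/
theorem hMne_maximalLevel_cm_two
    (νG : Measure (quasiSplit (↥(maximalRealSubfield L)) L (IsCMField.complexConj L) 2).Adelic) [νG.IsHaarMeasure] [νG.IsInvInvariant] [SFinite νG]
    (μKU : Measure ↥((standardMaximalCompactGL 2 L).comap (adelicVal (↥(maximalRealSubfield L)) L (IsCMField.complexConj L) 2 ((StdForm.antidiagonal 2).over L)) : Subgroup (quasiSplit (↥(maximalRealSubfield L)) L (IsCMField.complexConj L) 2).Adelic)) [μKU.IsHaarMeasure]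
    (νI : Measure (AdeleRing (𝓞 L) L)ˣ) [νI.IsHaarMeasure]
    {𝓕I : Set (AdeleRing (𝓞 L) L)ˣ} (h𝓕I : IsIdeleClassDomain L 𝓕I)
    (ν : Measure ↥(adelicUnipotent (↥(maximalRealSubfield L)) L (IsCMField.complexConj L) 2)) [ν.IsHaarMeasure] [ν.IsMulRightInvariant] [ν.IsInvInvariant]
    {𝓕 : Set ↥(adelicUnipotent (↥(maximalRealSubfield L)) L (IsCMField.complexConj L) 2)} (h𝓕N : IsFundamentalDomain ↥(rationalUnipotent (↥(maximalRealSubfield L)) L (IsCMField.complexConj L) 2) 𝓕 ν) (h𝓕1 : ν 𝓕 = 1)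
    (h𝓕c : IsCompact (closure 𝓕))
    {β : (quasiSplit (↥(maximalRealSubfield L)) L (IsCMField.complexConj L) 2).Adelic → ℝ≥0∞} (hβ : IsCoveringWeight ↥((arithmeticBorel (↥(maximalRealSubfield L)) L (IsCMField.complexConj L) 2).map (quasiSplit (↥(maximalRealSubfield L)) L (IsCMField.complexConj L) 2).arithmeticSubgroup.subtype) β)
    {μZ : Measure (borelQuotient (↥(maximalRealSubfield L)) L (IsCMField.complexConj L) 2)} [SFinite μZ]
    (hμZ : ∀ f : borelQuotient (↥(maximalRealSubfield L)) L (IsCMField.complexConj L) 2 → ℝ≥0∞, Measurable f → ∫⁻ z, f z ∂μZ = ∫⁻ g, β g * f (toBorelQuotient (↥(maximalRealSubfield L)) L (IsCMField.complexConj L) 2 g) ∂νG)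
    {χ : HeckeCharacter L} (hχ : χ.IsUnitary) (hρ : ∀ r : ℝ≥0ˣ, χ (posRealIdele L r) = 1) (hsd : reflectChar (IsCMField.complexConj L) χ = χ)
    {φ : (quasiSplit (↥(maximalRealSubfield L)) L (IsCMField.complexConj L) 2).Adelic → ℂ} (hφV : φ ∈ chiSectionSpace χ ((standardMaximalCompactGL 2 L).comap (adelicVal (↥(maximalRealSubfield L)) L (IsCMField.complexConj L) 2 ((StdForm.antidiagonal 2).over L)) : Subgroup (quasiSplit (↥(maximalRealSubfield L)) L (IsCMField.complexConj L) 2).Adelic) (fun _ => 1)) (hφc : Continuous φ) {Mφ : ℝ} (hφM : ∀ x, ‖φ x‖ ≤ Mφ)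
    (hφinf : ∀ a : arch (↥(maximalRealSubfield L)) L (IsCMField.complexConj L) 2 ((StdForm.antidiagonal 2).over L), φ (archToAdelic (↥(maximalRealSubfield L)) L (IsCMField.complexConj L) 2 _ a) = φ 1)
    (hφ1 : φ 1 ≠ 0) (hφ1r : conj (φ 1) = φ 1) :
    ∃ (g : (quasiSplit (↥(maximalRealSubfield L)) L (IsCMField.complexConj L) 2).Adelic) (w₁ : ℂ), 1 < w₁.re ∧
      ∫ v : ↥(adelicUnipotent (↥(maximalRealSubfield L)) L (IsCMField.complexConj L) 2), flatSectionU φ w₁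
        (((quasiSplit (↥(maximalRealSubfield L)) L (IsCMField.complexConj L) 2).toAdelic (weylLongU ((IsCMField.complexConj L : L ≃ₐ[↥(maximalRealSubfield L)] L) : L →+* L) (rfl : ((StdForm.antidiagonal 2).over L) = ((StdForm.antidiagonal 2).over L)))) * ((v : (quasiSplit (↥(maximalRealSubfield L)) L (IsCMField.complexConj L) 2).Adelic) * g)) ∂ν ≠ 0 := by
  classical
  have hφ0 : φ ≠ 0 := fun h => hφ1 (by rw [h, Pi.zero_apply])
  have h𝓕₀ : ν 𝓕 ≠ 0 := by rw [h𝓕1]; exact one_ne_zero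
  have hpk := chi_scattering_real_poles_m1_complete_cm_two L μ νG μKU νI h𝓕I ν h𝓕N h𝓕1 h𝓕c hβ hμZ hχ hρ hsd hφV hφc hφM hφinf hφ1 hφ1r
  refine hpk.elim fun bV h => h.elim fun q h => h.elim fun Ec h => h.elim fun qc h => h.elim fun P h => ?_
  have hbV := h.1
  have hcl := h.2.1
  have hs_tube := h.2.2.1
  have hqφ : ∀ z : ℂ, 1 < z.re → (∑ j, q j z • φ) = ((((ν 𝓕).toReal⁻¹ : ℝ)) : ℂ) • (fun g : (quasiSplit (↥(maximalRealSubfield L)) L (IsCMField.complexConj L) 2).Adelic => (∫ v : ↥(adelicUnipotent (↥(maximalRealSubfield L)) L (IsCMField.complexConj L) 2), flatSectionU φ z (((quasiSplit (↥(maximalRealSubfield L)) L (IsCMField.complexConj L) 2).toAdelic (weylLongU ((IsCMField.complexConj L : L ≃ₐ[↥(maximalRealSubfield L)] L) : L →+* L) (rfl : ((StdForm.antidiagonal 2).over L) = ((StdForm.antidiagonal 2).over L)))) * ((v : (quasiSplit (↥(maximalRealSubfield L)) L (IsCMField.complexConj L) 2).Adelic) * g)) ∂ν) * (((borelHeight g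 : ℝ) : ℂ) ^ (z - 1))) := fun z hz => by
    rw [← hcl.2.1 z hz]
    exact Finset.sum_congr rfl fun j _ => by rw [hbV j]
  have hqcq := hcl.2.2.2.2.2.1
  have hPc := hcl.2.2.2.2.2.2.1
  have hPcd := hcl.2.2.2.2.2.2.2.1
  have hPre := hcl.2.2.2.2.2.2.2.2.1
  have hqa := hcl.2.2.2.2.2.2.2.2.2.2.1
  have hFE := chi_scattering_fe_m1_cm_two L μ νG ν h𝓕N h𝓕c h𝓕₀ hβ hμZ hsd hφV hφc hφM hφinf hφ0 hqφ hqcq hPc hPcd hPre hqa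
  -- a point `s₁ ∉ P` with `Re s₁ < 0`, from codiscreteness of `P` at `−1`
  have hre : ∀ᶠ s in 𝓝[≠] (-1 : ℂ), s.re < 0 :=
    mem_nhdsWithin_of_mem_nhds ((Complex.continuous_re.tendsto (-1 : ℂ)).eventually (gt_mem_nhds (by norm_num)))
  obtain ⟨s₁, hs₁P, hs₁re⟩ := ((hPcd (-1)).and hre).exists
  have hz₀re : 1 < (1 - s₁).re := by rw [Complex.sub_re, Complex.one_re]; linarith
  have hz₀P : (1 - s₁) ∉ P := fun hP => by have := hPre _ hP; linarith
  have hne : qc default (1 - s₁) ≠ 0 := by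
    intro h0
    have h1 := hFE (1 - s₁) hz₀P (by rw [sub_sub_cancel]; exact hs₁P)
    rw [h0, zero_mul] at h1
    exact zero_ne_one h1
  refine ⟨1, 1 - s₁, hz₀re, fun hint => hne ?_⟩
  rw [hs_tube _ hz₀re, hint, mul_zero, mul_zero]

end Mne

/-! ## §3 The all-of-`L²` self-dual intertwining, `hsymm` discharged -/

section Intertwining

variable [MeasurableSpace (AdeleRing (𝓞 L) L)ˣ] [BorelSpace (AdeleRing (𝓞 L) L)ˣ]
  [(quasiSplit (↥(maximalRealSubfield L)) L (IsCMField.complexConj L) 2).IsAutomorphicMeasure μ]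

set_option maxHeartbeats 400000 in
/-- **`R(η)Θ ⊆ Θ` AND THE INTERTWINING ON `Θ` FOR THE SELF-DUAL FAMILY, `hsymm` DISCHARGED** (★ `hU_selfDual_cm_two` on the rank-one family indexed by ALL `C²_c((0,∞))`-profiles, closed under
the smoothing profile of `η` by ★ `contDiff_smoothingProfile` ∕ `hasCompactSupport_smoothingProfile` ∕ `tsupport_smoothingProfile_subset_Ioi`; `hsymm` = ★ `symbol_axis_symm` ∘ ★
`chi_symbol_symm_of_selfDual_cm_two` ∘ §2).  `η` is ANY test function acting on the flat sections of `V(χ, K, 1)` by an entire symbol `ŝ`; `(T, r, w, U_iso)` are ★ p861360 §3's outputs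
at `(α, c, v, f) := (Unit, 1, ṽ, f)`. [cite: MoeglinWaldspurger1995, II.2.4, IV.1.10, IV.3.12] -/
theorem hU_selfDual_on_closedSpan [ENNReal.HolderTriple ∞ 2 2]
    [LocallyCompactSpace (quasiSplit (↥(maximalRealSubfield L)) L (IsCMField.complexConj L) 2).Adelic] [SecondCountableTopology (quasiSplit (↥(maximalRealSubfield L)) L (IsCMField.complexConj L) 2).Adelic]
    (νG : Measure (quasiSplit (↥(maximalRealSubfield L)) L (IsCMField.complexConj L) 2).Adelic) [νG.IsHaarMeasure] [νG.IsInvInvariant] [SFinite νG]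
    (μKU : Measure ↥((standardMaximalCompactGL 2 L).comap (adelicVal (↥(maximalRealSubfield L)) L (IsCMField.complexConj L) 2 ((StdForm.antidiagonal 2).over L)) : Subgroup (quasiSplit (↥(maximalRealSubfield L)) L (IsCMField.complexConj L) 2).Adelic)) [μKU.IsHaarMeasure]
    (νI : Measure (AdeleRing (𝓞 L) L)ˣ) [νI.IsHaarMeasure]
    {𝓕I : Set (AdeleRing (𝓞 L) L)ˣ} (h𝓕I : IsIdeleClassDomain L 𝓕I)
    (ν : Measure ↥(adelicUnipotent (↥(maximalRealSubfield L)) L (IsCMField.complexConj L) 2)) [ν.IsHaarMeasure] [ν.IsMulRightInvariant] [ν.IsInvInvariant]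
    {𝓕 : Set ↥(adelicUnipotent (↥(maximalRealSubfield L)) L (IsCMField.complexConj L) 2)} (h𝓕N : IsFundamentalDomain ↥(rationalUnipotent (↥(maximalRealSubfield L)) L (IsCMField.complexConj L) 2) 𝓕 ν) (h𝓕1 : ν 𝓕 = 1)
    (h𝓕c : IsCompact (closure 𝓕))
    {β : (quasiSplit (↥(maximalRealSubfield L)) L (IsCMField.complexConj L) 2).Adelic → ℝ≥0∞} (hβ : IsCoveringWeight ↥((arithmeticBorel (↥(maximalRealSubfield L)) L (IsCMField.complexConj L) 2).map (quasiSplit (↥(maximalRealSubfield L)) L (IsCMField.complexConj L) 2).arithmeticSubgroup.subtype) β)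
    {μZ : Measure (borelQuotient (↥(maximalRealSubfield L)) L (IsCMField.complexConj L) 2)} [SFinite μZ]
    (hμZ : ∀ f : borelQuotient (↥(maximalRealSubfield L)) L (IsCMField.complexConj L) 2 → ℝ≥0∞, Measurable f → ∫⁻ z, f z ∂μZ = ∫⁻ g, β g * f (toBorelQuotient (↥(maximalRealSubfield L)) L (IsCMField.complexConj L) 2 g) ∂νG)
    {χ : HeckeCharacter L} (hχ : χ.IsUnitary) (hρ : ∀ r : ℝ≥0ˣ, χ (posRealIdele L r) = 1) (hsd : reflectChar (IsCMField.complexConj L) χ = χ)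
    {φ : (quasiSplit (↥(maximalRealSubfield L)) L (IsCMField.complexConj L) 2).Adelic → ℂ} (hφV : φ ∈ chiSectionSpace χ ((standardMaximalCompactGL 2 L).comap (adelicVal (↥(maximalRealSubfield L)) L (IsCMField.complexConj L) 2 ((StdForm.antidiagonal 2).over L)) : Subgroup (quasiSplit (↥(maximalRealSubfield L)) L (IsCMField.complexConj L) 2).Adelic) (fun _ => 1)) (hφc : Continuous φ) {Mφ : ℝ} (hφM : ∀ x, ‖φ x‖ ≤ Mφ)
    (hφinf : ∀ a : arch (↥(maximalRealSubfield L)) L (IsCMField.complexConj L) 2 ((StdForm.antidiagonal 2).over L), φ (archToAdelic (↥(maximalRealSubfield L)) L (IsCMField.complexConj L) 2 _ a) = φ 1)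
    (hφ1 : φ 1 ≠ 0) (hφ1r : conj (φ 1) = φ 1)
    (η : C_c((quasiSplit (↥(maximalRealSubfield L)) L (IsCMField.complexConj L) 2).Adelic, ℂ)) {ŝ : ℂ → ℂ} (hŝd : Differentiable ℂ ŝ)
    (hact : ∀ (z : ℂ), ∀ ψ ∈ chiSectionSpace χ ((standardMaximalCompactGL 2 L).comap (adelicVal (↥(maximalRealSubfield L)) L (IsCMField.complexConj L) 2 ((StdForm.antidiagonal 2).over L)) : Subgroup (quasiSplit (↥(maximalRealSubfield L)) L (IsCMField.complexConj L) 2).Adelic) 1, ∀ x : (quasiSplit (↥(maximalRealSubfield L)) L (IsCMField.complexConj L) 2).Adelic, (∫ y, η y * flatSectionU ψ z (x * y) ∂νG) = ŝ z * flatSectionU ψ z x)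
    {Idx : Set (ℝ → ℂ)} (hI : Idx = {f : ℝ → ℂ | ContDiff ℝ 2 f ∧ HasCompactSupport f ∧ tsupport f ⊆ Ioi 0})
    (y : ↥Idx → Unit → Lp ℂ 2 μ)
    (hy : ∀ (i : ↥Idx) (a : Unit), (y i a : (quasiSplit (↥(maximalRealSubfield L)) L (IsCMField.complexConj L) 2).automorphicQuotient → ℂ) =ᵐ[μ] (quasiSplit (↥(maximalRealSubfield L)) L (IsCMField.complexConj L) 2).quotFun (eisensteinSeriesU (fun g : (quasiSplit (↥(maximalRealSubfield L)) L (IsCMField.complexConj L) 2).Adelic => (i : ℝ → ℂ) (borelHeight g : ℝ) * ((fun _ : Unit => (1 : ℂ) • φ) a) g)))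
    {W : Type*} [NormedAddCommGroup W] [InnerProductSpace ℂ W] [FiniteDimensional ℂ W] (vA : Unit → W)
    (s : ℂ → ℂ) (S : Finset ℝ) {C : ℝ} (T : ↥S → W →L[ℂ] W) (r : ↥Idx → PiLp 2 (fun _ : ↥S => W)) (w : ↥Idx → Lp W 2 ((volume : Measure ℝ).restrict (Ioi 0)))
    (Uiso : (Submodule.span ℂ (Set.range fun i : ↥Idx => ∑ a, y i a)).topologicalClosure →ₗᵢ[ℂ] WithLp 2 (PiLp 2 (fun _ : ↥S => W) × Lp W 2 ((volume : Measure ℝ).restrict (Ioi 0))))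
    (hr_apply : ∀ i (c : ↥S), r i c = ((Real.sqrt C : ℝ) : ℂ) • T c (∑ a, mellin ((fun (i : ↥Idx) (_ : Unit) => (i : ℝ → ℂ)) i a) (-((c : ℝ) : ℂ)) • vA a))
    (hw : ∀ i, (w i : ℝ → W) =ᵐ[(volume : Measure ℝ).restrict (Ioi 0)] fun t =>
      (∑ a, mellin ((fun (i : ↥Idx) (_ : Unit) => (i : ℝ → ℂ)) i a) (-((((1 / 2 : ℝ)) : ℂ) + t * I)) • vA a) +
        s ((((1 / 2 : ℝ)) : ℂ) + ((-t : ℝ) : ℂ) * I) • ∑ a, mellin ((fun (i : ↥Idx) (_ : Unit) => (i : ℝ → ℂ)) i a) (-((((1 / 2 : ℝ)) : ℂ) + ((-t : ℝ) : ℂ) * I)) • vA a)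
    (hU : ∀ i, Uiso ⟨∑ a, y i a, mem_topologicalClosure_span (fun i => ∑ a, y i a) i⟩ = WithLp.toLp 2 (r i, ((Real.sqrt (C * (2 * π)⁻¹) : ℝ) : ℂ) • w i)) :
    ∃ hσ : MemLp (fun t : ℝ => ŝ ((((1 / 2 : ℝ)) : ℂ) + t * I)) ∞ ((volume : Measure ℝ).restrict (Ioi 0)),
      ∀ (x₀ : Lp ℂ 2 μ) (hv : x₀ ∈ (Submodule.span ℂ (Set.range fun i : ↥Idx => ∑ a, y i a)).topologicalClosure),
        ∃ hRv : (((quasiSplit (↥(maximalRealSubfield L)) L (IsCMField.complexConj L) 2).rightRegular μ).integratedOperator ((quasiSplit (↥(maximalRealSubfield L)) L (IsCMField.complexConj L) 2).isUnitary_rightRegular μ) ((quasiSplit (↥(maximalRealSubfield L)) L (IsCMField.complexConj L) 2).isStronglyContinuous_rightRegular_holds μ) νG η) x₀ ∈ (Submodule.span ℂ (Set.range fun i : ↥Idx => ∑ a, y i a)).topologicalClosure,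
          Uiso ⟨_, hRv⟩ = WithLp.toLp 2 (WithLp.toLp 2 (fun c : ↥S => ŝ ((c : ℝ) : ℂ) • (Uiso ⟨x₀, hv⟩).fst c),
            (hσ.toLp _ : Lp ℂ ∞ ((volume : Measure ℝ).restrict (Ioi 0))) • (Uiso ⟨x₀, hv⟩).snd) := by
  subst hI
  -- the M1 datum in ★ `hU_selfDual_cm_two`'s currency (`α := Unit`, sections `1 • φ`, base point `k₀ := 1`)
  have hφ' : ∀ _ : Unit, IsChiSection χ ((fun _ : Unit => (1 : ℂ) • φ) ()) := fun _ => (isChiSection_of_mem hφV).smul _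
  have hφc' : ∀ _ : Unit, Continuous ((fun _ : Unit => (1 : ℂ) • φ) ()) := fun _ => hφc.const_smul _
  have hφM' : ∀ (_ : Unit) (x : (quasiSplit (↥(maximalRealSubfield L)) L (IsCMField.complexConj L) 2).Adelic), ‖((fun _ : Unit => (1 : ℂ) • φ) ()) x‖ ≤ (fun _ : Unit => Mφ) () := fun _ x => by
    show ‖((1 : ℂ) • φ) x‖ ≤ Mφ
    rw [Pi.smul_apply, one_smul]; exact hφM x
  have hk₀ : ∀ _ : Unit, adelicVal (↥(maximalRealSubfield L)) L (IsCMField.complexConj L) 2 ((StdForm.antidiagonal 2).over L) ((fun _ : Unit => (1 : (quasiSplit (↥(maximalRealSubfield L)) L (IsCMField.complexConj L) 2).Adelic)) ()) ∈ standardMaximalCompactGL 2 L := fun _ => by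
    show adelicVal (↥(maximalRealSubfield L)) L (IsCMField.complexConj L) 2 ((StdForm.antidiagonal 2).over L) 1 ∈ standardMaximalCompactGL 2 L
    rw [map_one]; exact one_mem _
  have hx₀ : ∀ _ : Unit, ((fun _ : Unit => (1 : ℂ) • φ) ()) ((fun _ : Unit => (1 : (quasiSplit (↥(maximalRealSubfield L)) L (IsCMField.complexConj L) 2).Adelic)) ()) ≠ 0 := fun _ => by
    show ((1 : ℂ) • φ) 1 ≠ 0
    rw [Pi.smul_apply, one_smul]; exact hφ1
  have hmem : ∀ i : ↥{f : ℝ → ℂ | ContDiff ℝ 2 f ∧ HasCompactSupport f ∧ tsupport f ⊆ Ioi 0}, (i : ℝ → ℂ) ∈ {f : ℝ → ℂ | ContDiff ℝ 2 f ∧ HasCompactSupport f ∧ tsupport f ⊆ Ioi 0} := fun i => i.2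
  have hf : ∀ (i : ↥{f : ℝ → ℂ | ContDiff ℝ 2 f ∧ HasCompactSupport f ∧ tsupport f ⊆ Ioi 0}) (_ : Unit), ContDiff ℝ 2 ((fun (i : ↥{f : ℝ → ℂ | ContDiff ℝ 2 f ∧ HasCompactSupport f ∧ tsupport f ⊆ Ioi 0}) (_ : Unit) => (i : ℝ → ℂ)) i ()) := fun i _ => (hmem i).1
  have hfs : ∀ (i : ↥{f : ℝ → ℂ | ContDiff ℝ 2 f ∧ HasCompactSupport f ∧ tsupport f ⊆ Ioi 0}) (_ : Unit), HasCompactSupport ((fun (i : ↥{f : ℝ → ℂ | ContDiff ℝ 2 f ∧ HasCompactSupport f ∧ tsupport f ⊆ Ioi 0}) (_ : Unit) => (i : ℝ → ℂ)) i ()) := fun i _ => (hmem i).2.1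
  have hf0 : ∀ (i : ↥{f : ℝ → ℂ | ContDiff ℝ 2 f ∧ HasCompactSupport f ∧ tsupport f ⊆ Ioi 0}) (_ : Unit), tsupport ((fun (i : ↥{f : ℝ → ℂ | ContDiff ℝ 2 f ∧ HasCompactSupport f ∧ tsupport f ⊆ Ioi 0}) (_ : Unit) => (i : ℝ → ℂ)) i ()) ⊆ Ioi 0 := fun i _ => (hmem i).2.2
  have hact' : ∀ (a : Unit) (z : ℂ) (x : (quasiSplit (↥(maximalRealSubfield L)) L (IsCMField.complexConj L) 2).Adelic), ∫ y', η y' * flatSectionU ((fun _ : Unit => (1 : ℂ) • φ) a) z (x * y') ∂νG = ŝ z * flatSectionU ((fun _ : Unit => (1 : ℂ) • φ) a) z x :=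
    fun _ z x => hact z _ (Submodule.smul_mem _ _ hφV) x
  -- `hsymm`: ★ K2E2-p12 with §2's `hMne`, read on the axis by ★ `symbol_axis_symm`
  have hMne := hMne_maximalLevel_cm_two L μ νG μKU νI h𝓕I ν h𝓕N h𝓕1 h𝓕c hβ hμZ hχ hρ hsd hφV hφc hφM hφinf hφ1 hφ1r
  have hsymm : ∀ t : ℝ, ŝ ((((1 / 2 : ℝ)) : ℂ) + ((-t : ℝ) : ℂ) * I) = ŝ ((((1 / 2 : ℝ)) : ℂ) + t * I) :=
    symbol_axis_symm (chi_symbol_symm_of_selfDual_cm_two L νG ν h𝓕N h𝓕c hsd le_rfl hφV hφc.measurable hφM η.continuous η.hasCompactSupport ŝ hŝd hact hMne)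
  -- the family is closed under the smoothing profile of `η` (base point `1`)
  have hτmem : ∀ i : ↥{f : ℝ → ℂ | ContDiff ℝ 2 f ∧ HasCompactSupport f ∧ tsupport f ⊆ Ioi 0}, (fun r : ℝ => ∫ w', (i : ℝ → ℂ) (r * (borelHeight w' : ℝ)) * (η (((fun _ : Unit => (1 : (quasiSplit (↥(maximalRealSubfield L)) L (IsCMField.complexConj L) 2).Adelic)) ())⁻¹ * w') * (((fun _ : Unit => (1 : ℂ) • φ) ()) w' / ((fun _ : Unit => (1 : ℂ) • φ) ()) ((fun _ : Unit => (1 : (quasiSplit (↥(maximalRealSubfield L)) L (IsCMField.complexConj L) 2).Adelic)) ()))) ∂νG) ∈ {f : ℝ → ℂ | ContDiff ℝ 2 f ∧ HasCompactSupport f ∧ tsupport f ⊆ Ioi 0} := fun i =>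
    ⟨contDiff_smoothingProfile νG η.continuous η.hasCompactSupport (hφc' ()) _ (hf i ()) (hfs i ()),
      hasCompactSupport_smoothingProfile νG η.hasCompactSupport _ _ (hfs i ()) (hf0 i ()),
      tsupport_smoothingProfile_subset_Ioi νG η.hasCompactSupport _ _ (hfs i ()) (hf0 i ())⟩
  obtain ⟨hσ, hon⟩ := hU_selfDual_cm_two L μ νG η hφ' hφc' (fun _ : Unit => Mφ) hφM' (fun _ : Unit => (1 : (quasiSplit (↥(maximalRealSubfield L)) L (IsCMField.complexConj L) 2).Adelic)) hk₀ hx₀ hf hfs hf0 hŝd.continuous hact' hsymm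
    y hy (fun i => ⟨_, hτmem i⟩) (fun _ _ => rfl) (fun i a => hy ⟨_, hτmem i⟩ a) vA (fun z => s z • LinearMap.id) S T r w Uiso hr_apply (fun i => hw i) hU
  exact ⟨hσ, hon⟩

/-- **`U(R(η)v) = ((ŝ(c)•(U v)_c)_c, ŝ(½+i·)•(U v)_cont)` FOR EVERY `v ∈ L²(X)`, `U = U_iso ∘ P_Θ`** (★ `hU_selfDual_global` with `hadjΘ` discharged: `R(η)† = R(η)` for the real symmetric `η`, ★
`adjoint_integratedOperator`, and `R(η)Θ ⊆ Θ` by `hU_selfDual_on_closedSpan`). [cite: MoeglinWaldspurger1995, II.2.4, VI.2] [cite: ReedSimonI1980, Thm. II.3] -/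
theorem exists_selfDual_modelMap_intertwining [ENNReal.HolderTriple ∞ 2 2]
    [LocallyCompactSpace (quasiSplit (↥(maximalRealSubfield L)) L (IsCMField.complexConj L) 2).Adelic] [SecondCountableTopology (quasiSplit (↥(maximalRealSubfield L)) L (IsCMField.complexConj L) 2).Adelic]
    (νG : Measure (quasiSplit (↥(maximalRealSubfield L)) L (IsCMField.complexConj L) 2).Adelic) [νG.IsHaarMeasure] [νG.IsInvInvariant] [SFinite νG]
    (μKU : Measure ↥((standardMaximalCompactGL 2 L).comap (adelicVal (↥(maximalRealSubfield L)) L (IsCMField.complexConj L) 2 ((StdForm.antidiagonal 2).over L)) : Subgroup (quasiSplit (↥(maximalRealSubfield L)) L (IsCMField.complexConj L) 2).Adelic)) [μKU.IsHaarMeasure]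
    (νI : Measure (AdeleRing (𝓞 L) L)ˣ) [νI.IsHaarMeasure]
    {𝓕I : Set (AdeleRing (𝓞 L) L)ˣ} (h𝓕I : IsIdeleClassDomain L 𝓕I)
    (ν : Measure ↥(adelicUnipotent (↥(maximalRealSubfield L)) L (IsCMField.complexConj L) 2)) [ν.IsHaarMeasure] [ν.IsMulRightInvariant] [ν.IsInvInvariant]
    {𝓕 : Set ↥(adelicUnipotent (↥(maximalRealSubfield L)) L (IsCMField.complexConj L) 2)} (h𝓕N : IsFundamentalDomain ↥(rationalUnipotent (↥(maximalRealSubfield L)) L (IsCMField.complexConj L) 2) 𝓕 ν) (h𝓕1 : ν 𝓕 = 1)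
    (h𝓕c : IsCompact (closure 𝓕))
    {β : (quasiSplit (↥(maximalRealSubfield L)) L (IsCMField.complexConj L) 2).Adelic → ℝ≥0∞} (hβ : IsCoveringWeight ↥((arithmeticBorel (↥(maximalRealSubfield L)) L (IsCMField.complexConj L) 2).map (quasiSplit (↥(maximalRealSubfield L)) L (IsCMField.complexConj L) 2).arithmeticSubgroup.subtype) β)
    {μZ : Measure (borelQuotient (↥(maximalRealSubfield L)) L (IsCMField.complexConj L) 2)} [SFinite μZ]
    (hμZ : ∀ f : borelQuotient (↥(maximalRealSubfield L)) L (IsCMField.complexConj L) 2 → ℝ≥0∞, Measurable f → ∫⁻ z, f z ∂μZ = ∫⁻ g, β g * f (toBorelQuotient (↥(maximalRealSubfield L)) L (IsCMField.complexConj L) 2 g) ∂νG)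
    {χ : HeckeCharacter L} (hχ : χ.IsUnitary) (hρ : ∀ r : ℝ≥0ˣ, χ (posRealIdele L r) = 1) (hsd : reflectChar (IsCMField.complexConj L) χ = χ)
    {φ : (quasiSplit (↥(maximalRealSubfield L)) L (IsCMField.complexConj L) 2).Adelic → ℂ} (hφV : φ ∈ chiSectionSpace χ ((standardMaximalCompactGL 2 L).comap (adelicVal (↥(maximalRealSubfield L)) L (IsCMField.complexConj L) 2 ((StdForm.antidiagonal 2).over L)) : Subgroup (quasiSplit (↥(maximalRealSubfield L)) L (IsCMField.complexConj L) 2).Adelic) (fun _ => 1)) (hφc : Continuous φ) {Mφ : ℝ} (hφM : ∀ x, ‖φ x‖ ≤ Mφ)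
    (hφinf : ∀ a : arch (↥(maximalRealSubfield L)) L (IsCMField.complexConj L) 2 ((StdForm.antidiagonal 2).over L), φ (archToAdelic (↥(maximalRealSubfield L)) L (IsCMField.complexConj L) 2 _ a) = φ 1)
    (hφ1 : φ 1 ≠ 0) (hφ1r : conj (φ 1) = φ 1)
    (η : C_c((quasiSplit (↥(maximalRealSubfield L)) L (IsCMField.complexConj L) 2).Adelic, ℂ)) (hηsymm : ∀ g, η g⁻¹ = η g) (hηreal : ∀ g, conj (η g) = η g) {ŝ : ℂ → ℂ} (hŝd : Differentiable ℂ ŝ)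
    (hact : ∀ (z : ℂ), ∀ ψ ∈ chiSectionSpace χ ((standardMaximalCompactGL 2 L).comap (adelicVal (↥(maximalRealSubfield L)) L (IsCMField.complexConj L) 2 ((StdForm.antidiagonal 2).over L)) : Subgroup (quasiSplit (↥(maximalRealSubfield L)) L (IsCMField.complexConj L) 2).Adelic) 1, ∀ x : (quasiSplit (↥(maximalRealSubfield L)) L (IsCMField.complexConj L) 2).Adelic, (∫ y, η y * flatSectionU ψ z (x * y) ∂νG) = ŝ z * flatSectionU ψ z x)
    {Idx : Set (ℝ → ℂ)} (hI : Idx = {f : ℝ → ℂ | ContDiff ℝ 2 f ∧ HasCompactSupport f ∧ tsupport f ⊆ Ioi 0})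
    (y : ↥Idx → Unit → Lp ℂ 2 μ)
    (hy : ∀ (i : ↥Idx) (a : Unit), (y i a : (quasiSplit (↥(maximalRealSubfield L)) L (IsCMField.complexConj L) 2).automorphicQuotient → ℂ) =ᵐ[μ] (quasiSplit (↥(maximalRealSubfield L)) L (IsCMField.complexConj L) 2).quotFun (eisensteinSeriesU (fun g : (quasiSplit (↥(maximalRealSubfield L)) L (IsCMField.complexConj L) 2).Adelic => (i : ℝ → ℂ) (borelHeight g : ℝ) * ((fun _ : Unit => (1 : ℂ) • φ) a) g)))
    {W : Type*} [NormedAddCommGroup W] [InnerProductSpace ℂ W] [FiniteDimensional ℂ W] (vA : Unit → W)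
    (s : ℂ → ℂ) (S : Finset ℝ) {C : ℝ} (T : ↥S → W →L[ℂ] W) (r : ↥Idx → PiLp 2 (fun _ : ↥S => W)) (w : ↥Idx → Lp W 2 ((volume : Measure ℝ).restrict (Ioi 0)))
    (Uiso : (Submodule.span ℂ (Set.range fun i : ↥Idx => ∑ a, y i a)).topologicalClosure →ₗᵢ[ℂ] WithLp 2 (PiLp 2 (fun _ : ↥S => W) × Lp W 2 ((volume : Measure ℝ).restrict (Ioi 0))))
    (hr_apply : ∀ i (c : ↥S), r i c = ((Real.sqrt C : ℝ) : ℂ) • T c (∑ a, mellin ((fun (i : ↥Idx) (_ : Unit) => (i : ℝ → ℂ)) i a) (-((c : ℝ) : ℂ)) • vA a))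
    (hw : ∀ i, (w i : ℝ → W) =ᵐ[(volume : Measure ℝ).restrict (Ioi 0)] fun t =>
      (∑ a, mellin ((fun (i : ↥Idx) (_ : Unit) => (i : ℝ → ℂ)) i a) (-((((1 / 2 : ℝ)) : ℂ) + t * I)) • vA a) +
        s ((((1 / 2 : ℝ)) : ℂ) + ((-t : ℝ) : ℂ) * I) • ∑ a, mellin ((fun (i : ↥Idx) (_ : Unit) => (i : ℝ → ℂ)) i a) (-((((1 / 2 : ℝ)) : ℂ) + ((-t : ℝ) : ℂ) * I)) • vA a)
    (hU : ∀ i, Uiso ⟨∑ a, y i a, mem_topologicalClosure_span (fun i => ∑ a, y i a) i⟩ = WithLp.toLp 2 (r i, ((Real.sqrt (C * (2 * π)⁻¹) : ℝ) : ℂ) • w i)) :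
    ∃ hσ : MemLp (fun t : ℝ => ŝ ((((1 / 2 : ℝ)) : ℂ) + t * I)) ∞ ((volume : Measure ℝ).restrict (Ioi 0)),
      (∀ v ∈ (Submodule.span ℂ (Set.range fun i : ↥Idx => ∑ a, y i a)).topologicalClosure, (((quasiSplit (↥(maximalRealSubfield L)) L (IsCMField.complexConj L) 2).rightRegular μ).integratedOperator ((quasiSplit (↥(maximalRealSubfield L)) L (IsCMField.complexConj L) 2).isUnitary_rightRegular μ) ((quasiSplit (↥(maximalRealSubfield L)) L (IsCMField.complexConj L) 2).isStronglyContinuous_rightRegular_holds μ) νG η) v ∈ (Submodule.span ℂ (Set.range fun i : ↥Idx => ∑ a, y i a)).topologicalClosure) ∧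
      ∀ v : Lp ℂ 2 μ,
        haveI := completeSpace_topologicalClosure_span (fun i : ↥Idx => ∑ a, y i a)
        (Uiso.toContinuousLinearMap.comp (Submodule.span ℂ (Set.range fun i : ↥Idx => ∑ a, y i a)).topologicalClosure.orthogonalProjectionOnto) ((((quasiSplit (↥(maximalRealSubfield L)) L (IsCMField.complexConj L) 2).rightRegular μ).integratedOperator ((quasiSplit (↥(maximalRealSubfield L)) L (IsCMField.complexConj L) 2).isUnitary_rightRegular μ) ((quasiSplit (↥(maximalRealSubfield L)) L (IsCMField.complexConj L) 2).isStronglyContinuous_rightRegular_holds μ) νG η) v) =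
          WithLp.toLp 2 (WithLp.toLp 2 (fun c : ↥S => ŝ ((c : ℝ) : ℂ) • ((Uiso.toContinuousLinearMap.comp (Submodule.span ℂ (Set.range fun i : ↥Idx => ∑ a, y i a)).topologicalClosure.orthogonalProjectionOnto) v).fst c),
            (hσ.toLp _ : Lp ℂ ∞ ((volume : Measure ℝ).restrict (Ioi 0))) • ((Uiso.toContinuousLinearMap.comp (Submodule.span ℂ (Set.range fun i : ↥Idx => ∑ a, y i a)).topologicalClosure.orthogonalProjectionOnto) v).snd) := by
  obtain ⟨hσ, hon⟩ := hU_selfDual_on_closedSpan L μ νG μKU νI h𝓕I ν h𝓕N h𝓕1 h𝓕c hβ hμZ hχ hρ hsd hφV hφc hφM hφinf hφ1 hφ1r η hŝd hact hI y hy vA s S T r w Uiso hr_apply hw hU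
  have hstab : ∀ v ∈ (Submodule.span ℂ (Set.range fun i : ↥Idx => ∑ a, y i a)).topologicalClosure, (((quasiSplit (↥(maximalRealSubfield L)) L (IsCMField.complexConj L) 2).rightRegular μ).integratedOperator ((quasiSplit (↥(maximalRealSubfield L)) L (IsCMField.complexConj L) 2).isUnitary_rightRegular μ) ((quasiSplit (↥(maximalRealSubfield L)) L (IsCMField.complexConj L) 2).isStronglyContinuous_rightRegular_holds μ) νG η) v ∈ (Submodule.span ℂ (Set.range fun i : ↥Idx => ∑ a, y i a)).topologicalClosure :=
    fun v hv => (hon v hv).1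
  -- `R(η)† = R(η)` (real symmetric `η`) ⇒ `hadjΘ`
  have hadj : ContinuousLinearMap.adjoint (((quasiSplit (↥(maximalRealSubfield L)) L (IsCMField.complexConj L) 2).rightRegular μ).integratedOperator ((quasiSplit (↥(maximalRealSubfield L)) L (IsCMField.complexConj L) 2).isUnitary_rightRegular μ) ((quasiSplit (↥(maximalRealSubfield L)) L (IsCMField.complexConj L) 2).isStronglyContinuous_rightRegular_holds μ) νG η) = (((quasiSplit (↥(maximalRealSubfield L)) L (IsCMField.complexConj L) 2).rightRegular μ).integratedOperator ((quasiSplit (↥(maximalRealSubfield L)) L (IsCMField.complexConj L) 2).isUnitary_rightRegular μ) ((quasiSplit (↥(maximalRealSubfield L)) L (IsCMField.complexConj L) 2).isStronglyContinuous_rightRegular_holds μ) νG η) :=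
    ContRepresentation.adjoint_integratedOperator ((quasiSplit (↥(maximalRealSubfield L)) L (IsCMField.complexConj L) 2).isUnitary_rightRegular μ) ((quasiSplit (↥(maximalRealSubfield L)) L (IsCMField.complexConj L) 2).isStronglyContinuous_rightRegular_holds μ) νG η η fun g => by rw [mulStar, hηsymm, hηreal]
  have hadjΘ : ∀ v ∈ (Submodule.span ℂ (Set.range fun i : ↥Idx => ∑ a, y i a)).topologicalClosure, ContinuousLinearMap.adjoint (((quasiSplit (↥(maximalRealSubfield L)) L (IsCMField.complexConj L) 2).rightRegular μ).integratedOperator ((quasiSplit (↥(maximalRealSubfield L)) L (IsCMField.complexConj L) 2).isUnitary_rightRegular μ) ((quasiSplit (↥(maximalRealSubfield L)) L (IsCMField.complexConj L) 2).isStronglyContinuous_rightRegular_holds μ) νG η) v ∈ (Submodule.span ℂ (Set.range fun i : ↥Idx => ∑ a, y i a)).topologicalClosure :=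
    fun v hv => by rw [hadj]; exact hstab v hv
  exact ⟨hσ, hstab, fun v => hU_selfDual_global (fun i : ↥Idx => ∑ a, y i a) Uiso (((quasiSplit (↥(maximalRealSubfield L)) L (IsCMField.complexConj L) 2).rightRegular μ).integratedOperator ((quasiSplit (↥(maximalRealSubfield L)) L (IsCMField.complexConj L) 2).isUnitary_rightRegular μ) ((quasiSplit (↥(maximalRealSubfield L)) L (IsCMField.complexConj L) 2).isStronglyContinuous_rightRegular_holds μ) νG η) (fun c : ↥S => ŝ ((c : ℝ) : ℂ)) hσ hon hadjΘ v⟩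

end Intertwining

end Summit.HodgeConjecture.HodgeConjecture.Cruxes.H413.K2E1ResidualBlockPackageSelfDualFamilyCMTwo

end
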